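import Literature.NumberTheory.Automorphic.BrandtXiSetupIndependence
import Literature.NumberTheory.EllipticCurves.LevelLoweringPrimesCount
import Literature.NumberTheory.EllipticCurves.TakahashiDegreeFormulaCoprimeProofs
import Literature.NumberTheory.EllipticCurves.ModularDegreeMinimal
import Literature.NumberTheory.EllipticCurves.Szpiro
import Literature.NumberTheory.EllipticCurves.SzpiroFreyConductorProofs
import HarnessLib

/-!
# Stub-ideation k=1, GEN 12 — `stub_xiDegreeComparison` (line `p6_tamagawa_split`, crux `SteinbergCore`,
# stmt-ABC-15024): TAKAHASHI'S SQUARE IDENTITY WITHOUT OPTIMALITY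

Companion sketch of `STUB-IDEAS-stub_xiDegreeComparison-1.md` (gen 12).  Family 1 (recognise & import),
third import road (β3).  Everything here ELABORATES; `sorry` count = 0.

## The observation

Takahashi 2001 (J. Number Theory 90), proof of Thm. 2.3 (p. 80, first display): for a parametrisation
`π : X₀(Mr) → E` (`r ∥ N = Mr`, `E` of conductor `Mr`), with `π^* : X_r(E) = ℤ x_r → X_r(J₀(Mr))`,
`π_* ∘ π^* = deg π`, the adjunction `u_J(π^* x, y) = u_E(x, π_* y)` (SGA 7 IX) and `c_r(E) = u_E(x_r, x_r)`
(SGA 7 IX 11.5):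

  `deg π · c_r(E) = u_E(x_r, π_* π^* x_r) = u_J(π^* x_r, π^* x_r) = j_r² · h_r`,   `π^* x_r = j_r g_r`,

where `g_r` generates the (saturated, rank-one) `f`-eigenline of `X_r(J₀(Mr)) ≅ ℤ[Cls O]⁰` (Ribet 1990
Prop. 3.1; Takahashi p. 84) and `h_r = u_J(g_r, g_r) = Σ_i w_i g_{r,i}² = ξ(M, r)` is the route's `brandtXi`.
NOTHING in this display uses that `π` is an OPTIMAL quotient (optimality enters Takahashi's paper only
through the surjectivity of `π_*`, i.e. Lemma 2.2 and `i_r`).  Hence, for EVERY parametrisation datum `P`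
of EVERY curve `E` of conductor `Mr`:

  `(H♮)  c_r(E) · deg P = j² · ξ(M, r)` for some `j ∈ ℕ`,   in particular `ξ(M, r) ∣ c_r(E) · deg P`.

Applied to the Frey curve `E_{a,b}` itself (no optimal pivot, no isogeny transport, no Manin constant)
and a minimal datum `D`: `cps ξ(N/q, q) ≤ cps(deg D) · c_q(E_{a,b}) ≤ cps(deg D) · T`, which is child 1 of
the split AT PRIME TYPE (`hC` of `SteinbergCorePrimeRung.primeRung_of_subs_frey`, p162616) with `C = 1`,
`T¹ ≤ T³` and the `N^ε` idle (`primeComparison_of_sqIdentity` below).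

Compared with the landed conditional proof `xiDegreeComparison_prime_of_facts` (p137891, constant
`4·163²`, hypotheses `takahashi2001_thm_2_3_of_coprime` + `MazurKenkuBound` (stmt-ABC-15125) +
`IsogenyValuationTransport` (stmt-ABC-18928) + `FreyModularity`), the fact `XiSquareIdentity` REPLACES
the optimal-quotient form of Takahashi AND BOTH ASIDES (whose common residual `MazurKenkuRadius`,
stmt-ABC-15193, is open): `{XiSquareIdentity, FreyModularity} ⊢ hC`.

At an optimal `P`, `XiSquareIdentity` is a corollary of the tree's `takahashi2001_thm_2_3_of_coprime`
(`sq_identity_of_takahashi_data`); its new content is the non-optimal case, which is exactly what lets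
the Frey curve be used directly.

## References

* [Takahashi2001] S. Takahashi, Degrees of parametrizations of elliptic curves by Shimura curves,
  J. Number Theory 90 (2001) 74–88 — proof of Thm. 2.3, p. 80 lines 1–6; §1 Prop. 1.1; p. 78
  (adjunction); proof of Thm. 3.8, p. 84 (Brandt-module description of `X_r(J₀)` with its pairing).
* [SGA7] A. Grothendieck, SGA 7 I, exp. IX, §10 (monodromy pairing, functoriality) and Thm. 11.5.
* [Ribet1990] K. Ribet, On modular representations of Gal(Q̄/Q) arising from modular forms,
  Invent. Math. 100 (1990), Prop. 3.1, Thm. 3.10 (character group of `J₀(qM)` at `q` = Brandt module).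
* [ConradStein2001] B. Conrad, W. Stein, Component groups of purely toric quotients, Math. Res. Lett. 8
  (2001), §§2–3 (the maps `π^*`, `π_*` on character groups for arbitrary quotients).
-/

set_option linter.dupNamespace false

noncomputable section

namespace Summit.ABC.ABC.Cruxes.SteinbergCore.StubIdeasK1G12

open Literature.NumberTheory.EllipticCurves Literature.NumberTheory.EllipticCurves.ModularForms
open Literature.NumberTheory.Automorphic
open WeierstrassCurve

/-! ## Imports-light copies (this sketch imports Literature only, so that it elaborates on any farm snapshot)

`FreyModularity` below is VERBATIM the route item `Summit.ABC.ABC.Theses.DefiniteXi.FreyModularity`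
(stmt-ABC-11340); the `cps` lemmas are verbatim `Summit.ABC.ABC.Theorems.SteinbergCore.Negative.*`
(`SteinbergCoreDomain.lean` §A); `freyLocal` is verbatim `DefiniteRTControlPrime.stub_freyLocal`
(`DefiniteXiDefiniteRTControlPrimeFreyLocal.lean`).  A Theorems port replaces each copy by the import. -/

/-- VERBATIM copy of the route item `Summit.ABC.ABC.Theses.DefiniteXi.FreyModularity` (stmt-ABC-11340). [folklore] -/
def FreyModularity : Prop :=
  ∀ a b : ℤ, IsCoprime a b → a * b * (a + b) ≠ 0 → ∀ (N : ℕ) [NeZero N],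
    (freyCurve a b).conductorNorm ℤ = N → Nonempty (ModularParametrizationData (freyCurve a b) N)

/-- `2^{v₂ n} · 3^{v₃ n} ∣ n` (copy of `SteinbergCore.Negative.sixPart_dvd`). [folklore] -/
theorem sixPart_dvd (n : ℕ) : ordProj[2] n * ordProj[3] n ∣ n := by
  rcases Nat.eq_zero_or_pos n with rfl | _
  · exact dvd_zero _
  · exact Nat.Coprime.mul_dvd_of_dvd_of_dvd
      (Nat.Coprime.pow _ _ (by norm_num : Nat.Coprime 2 3)) (Nat.ordProj_dvd n 2) (Nat.ordProj_dvd n 3)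

/-- `0 < 2^{v₂ n} · 3^{v₃ n}`. [folklore] -/
theorem sixPart_pos (n : ℕ) : 0 < ordProj[2] n * ordProj[3] n := by positivity

/-- `1 ≤ cps n ↔ n ≠ 0` (copy of `SteinbergCore.Negative.one_le_primeToSix_iff`). [folklore] -/
theorem one_le_primeToSix_iff (n : ℕ) : 1 ≤ n / (ordProj[2] n * ordProj[3] n) ↔ n ≠ 0 := by
  rw [Nat.succ_le_iff, Nat.div_pos_iff]
  constructor
  · rintro ⟨-, h⟩ rfl
    exact absurd h (not_le.mpr (sixPart_pos 0))
  · intro h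
    exact ⟨sixPart_pos n, Nat.le_of_dvd (Nat.pos_of_ne_zero h) (sixPart_dvd n)⟩

/-- `cps n ≤ n`. [folklore] -/
theorem primeToSix_le (n : ℕ) : n / (ordProj[2] n * ordProj[3] n) ≤ n := Nat.div_le_self _ _

/-- `cps n = ordCompl[3] (ordCompl[2] n)` (copy). [folklore] -/
theorem primeToSix_eq_ordCompl (n : ℕ) :
    n / (ordProj[2] n * ordProj[3] n) = ordCompl[3] (ordCompl[2] n) := by
  have h3 : (ordCompl[2] n).factorization 3 = n.factorization 3 := by
    rw [Nat.factorization_div (Nat.ordProj_dvd n 2)]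
    simp [Nat.prime_two.factorization_pow]
  change n / (ordProj[2] n * ordProj[3] n) = n / ordProj[2] n / 3 ^ (ordCompl[2] n).factorization 3
  rw [h3, Nat.div_div_eq_div_mul]

/-- `cps` is multiplicative (copy of `SteinbergCore.Negative.primeToSix_mul`). [folklore] -/
theorem primeToSix_mul (m n : ℕ) :
    m * n / (ordProj[2] (m * n) * ordProj[3] (m * n)) =
      m / (ordProj[2] m * ordProj[3] m) * (n / (ordProj[2] n * ordProj[3] n)) := by
  rw [primeToSix_eq_ordCompl, primeToSix_eq_ordCompl, primeToSix_eq_ordCompl, Nat.ordCompl_mul,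
    Nat.ordCompl_mul]

/-- `cps m ≤ cps (m n)` for `n ≠ 0` (copy). [folklore] -/
theorem primeToSix_le_primeToSix_mul {m n : ℕ} (hn : n ≠ 0) :
    m / (ordProj[2] m * ordProj[3] m) ≤ m * n / (ordProj[2] (m * n) * ordProj[3] (m * n)) := by
  rw [primeToSix_mul]
  exact Nat.le_mul_of_pos_right _ ((one_le_primeToSix_iff n).mpr hn)

/-- **An odd prime of the conductor of a Frey curve divides it exactly once** (copy of
`DefiniteRTControlPrime.stub_freyLocal`: `N ∣ 2⁸ rad(ab(a+b))`, the radical is squarefree). [folklore] -/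
theorem freyLocal (a b : ℤ) (hab : IsCoprime a b) (h0 : a * b * (a + b) ≠ 0) (q : ℕ)
    (hq : q.Prime) (hq2 : q ≠ 2) (hqN : q ∣ (freyCurve a b).conductorNorm ℤ) :
    ((freyCurve a b).conductorNorm ℤ / q).Coprime q := by
  refine Nat.Coprime.symm ((Nat.Prime.coprime_iff_not_dvd hq).mpr fun hdvd => ?_)
  have hsqN : q * q ∣ (freyCurve a b).conductorNorm ℤ := by
    rw [← Nat.div_mul_cancel hqN]
    exact Nat.mul_dvd_mul hdvd dvd_rfl
  have hqq : q * q ∣ 2 ^ 8 * (UniqueFactorizationMonoid.radical (a * b * (a + b))).natAbs :=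
    hsqN.trans (conductorNorm_freyCurve_dvd_holds a b hab h0)
  have hq2' : Nat.Coprime q 2 := (Nat.coprime_primes hq Nat.prime_two).mpr hq2
  have hcop : Nat.Coprime (q * q) (2 ^ 8) :=
    Nat.Coprime.pow_right 8 (Nat.Coprime.mul_left hq2' hq2')
  have hsqR : Squarefree (UniqueFactorizationMonoid.radical (a * b * (a + b))).natAbs :=
    Int.squarefree_natAbs.mpr UniqueFactorizationMonoid.squarefree_radical
  exact hq.one_lt.ne' (Nat.isUnit_iff.mp (hsqR q (hcop.dvd_of_dvd_mul_left hqq)))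

/-! ## (H♮) The named fact: Takahashi's square identity for an arbitrary parametrisation -/

/-- **Takahashi's square identity, non-optimal form (H♮).**  For an elliptic curve `W/ℚ` of conductor
`M r` with `r` prime, `(M, r) = 1` (so `W` is multiplicative at `r`), ANY modular parametrisation datum `P`
of `W` at level `M r` and any Brandt setup `S` of type `(M, r)` whose `a(W)`-eigen-lattice is a line
(`ξ_S ≠ 0`): `ord_r(Δ_min(W)) · deg P = j² · ξ_S(a(W))` for some `j ∈ ℕ` — `j = [L_r(J) : π_P^* X_r(W)]`.
Takahashi 2001, proof of Thm. 2.3 (p. 80, first display) verbatim, whose ingredients (`π_* π^* = deg`,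
the SGA 7 IX adjunction, `c_r = u_E(x_r, x_r)`, and the identification of `(X_r(J₀(Mr)), u_J)` with the
Brandt module of level `M` in the quaternion algebra of discriminant `r`, p. 84) hold for every
parametrisation, optimal or not.  Same format as the tree's `takahashi2001_thm_2_3_of_coprime`, with the
optimality hypothesis on `P` DROPPED and the conclusion weakened from `(i, j)` to the square class.
[cite: Takahashi2001, proof of Thm. 2.3 (p. 80); Prop. 1.1; proof of Thm. 3.8 (p. 84)]
[cite: Ribet1990, Prop. 3.1, Thm. 3.10] [cite: ConradStein2001, §§2–3] -/
def XiSquareIdentity : Prop :=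
  ∀ (W : WeierstrassCurve ℚ) [W.IsElliptic] (M r : ℕ) [NeZero (M * r)],
    r.Prime → M.Coprime r → W.conductorNorm ℤ = M * r →
    ∀ (P : ModularParametrizationData W (M * r)) (S : Brandt.XiSetup M r),
      S.xi (fun n => W.LFunction n) ≠ 0 →
      ∃ j : ℕ, (W.minimalDiscriminantNorm ℤ).factorization r * P.modularDegree =
        j ^ 2 * S.xi (fun n => W.LFunction n)

/-- **At an optimal `P`, (H♮) is a corollary of Takahashi's Thm. 2.3 as filed in the tree**: from
`0 < i`, `i j = c_r`, `deg P · i = ξ j` one gets `c_r · deg P = j² ξ`.  (So the NEW content of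
`XiSquareIdentity` is the non-optimal case only.) [folklore] -/
theorem sq_identity_of_takahashi_data {c δ ξ i j : ℕ} (hi : 0 < i) (hij : i * j = c)
    (hδ : δ * i = ξ * j) : ∃ j' : ℕ, c * δ = j' ^ 2 * ξ := by
  refine ⟨j, ?_⟩
  have h : c * δ * i = j ^ 2 * ξ * i := by
    calc c * δ * i = i * j * (δ * i) := by rw [← hij]; ring
      _ = i * j * (ξ * j) := by rw [hδ]
      _ = j ^ 2 * ξ * i := by ring
  exact Nat.eq_of_mul_eq_mul_right hi h

/-! ## Helper lemmas (each one prover cycle; all PROVED here) -/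

/-- **L1 — the `cps` step.**  `c d = j² ξ` with `c, d ≠ 0` gives `cps ξ ≤ cps d · c`
(`cps` multiplicative, `cps ξ ≤ cps (ξ j²)`, `cps c ≤ c`; tree lemmas of
`SteinbergCore.Negative.SteinbergCoreDomain`). [folklore] -/
theorem primeToSix_le_of_sq_identity {ξ c d j : ℕ} (h : c * d = j ^ 2 * ξ) (hc : c ≠ 0)
    (hd : d ≠ 0) :
    ξ / (ordProj[2] ξ * ordProj[3] ξ) ≤ d / (ordProj[2] d * ordProj[3] d) * c := by
  have hj : j ^ 2 ≠ 0 := by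
    intro hj0
    rw [hj0, zero_mul] at h
    exact mul_ne_zero hc hd h
  calc ξ / (ordProj[2] ξ * ordProj[3] ξ)
      ≤ ξ * j ^ 2 / (ordProj[2] (ξ * j ^ 2) * ordProj[3] (ξ * j ^ 2)) :=
        primeToSix_le_primeToSix_mul hj
    _ = d * c / (ordProj[2] (d * c) * ordProj[3] (d * c)) := by rw [mul_comm ξ, ← h, mul_comm c]
    _ = d / (ordProj[2] d * ordProj[3] d) * (c / (ordProj[2] c * ordProj[3] c)) := primeToSix_mul _ _
    _ ≤ d / (ordProj[2] d * ordProj[3] d) * c := Nat.mul_le_mul_left _ (primeToSix_le _)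

/-- **L2 — the divisibility `ξ(N/q, q) ∣ c_q(E_{a,b}) · deg D` for EVERY datum `D` of the Frey curve**
(odd prime `q ∣ N`; from (H♮), `stub_freyLocal` for `(N/q, q) = 1`, setup existence and setup
independence `XiSetup.brandtXi_eq_xi`).  This is the form the route can also use one level up
(`ξ ≤ c_q · deg_min`, see the md, §Route-level note). [folklore] -/
theorem brandtXi_dvd_tamagawa_mul_deg (hH : XiSquareIdentity) {a b : ℤ} (hab : IsCoprime a b)
    (h0 : a * b * (a + b) ≠ 0) {N : ℕ} [NeZero N] (hN : (freyCurve a b).conductorNorm ℤ = N)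
    {q : ℕ} (hq : q.Prime) (hq2 : q ≠ 2) (hqN : q ∣ N)
    (hξ : brandtXi (N / q) q (fun n => (freyCurve a b).LFunction n) ≠ 0)
    (D : ModularParametrizationData (freyCurve a b) N) :
    brandtXi (N / q) q (fun n => (freyCurve a b).LFunction n) ∣
      ((freyCurve a b).minimalDiscriminantNorm ℤ).factorization q * D.deg := by
  obtain ⟨M, hM⟩ := hqN
  rw [mul_comm] at hM
  subst hM
  haveI := isElliptic_freyCurve h0
  have hdiv : M * q / q = M := Nat.mul_div_cancel M hq.pos
  have hqN' : q ∣ (freyCurve a b).conductorNorm ℤ := by rw [hN]; exact Dvd.intro_left M rfl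
  have hcop : M.Coprime q := by
    have h := freyLocal a b hab h0 q hq hq2 hqN'
    rwa [hN, hdiv] at h
  obtain ⟨S⟩ := takahashi2001_thm_2_3_of_coprime.nonempty_xiSetup' (M := M) hq hcop
  rw [hdiv] at hξ ⊢
  rw [Brandt.XiSetup.brandtXi_eq_xi S] at hξ ⊢
  obtain ⟨j, hj⟩ := hH (freyCurve a b) M q hq hcop hN D S hξ
  refine ⟨j ^ 2, ?_⟩
  change ((freyCurve a b).minimalDiscriminantNorm ℤ).factorization q * D.modularDegree = _
  rw [hj, mul_comm]

/-- **L3 — one factor of `T` is at most `T`** (every factor `v_p(Δ_min)`, `p ∣ N`, is `≥ 1`). [folklore] -/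
theorem factorization_le_tamProd {a b : ℤ} (h0 : a * b * (a + b) ≠ 0) {N : ℕ} [NeZero N]
    (hN : (freyCurve a b).conductorNorm ℤ = N) {q : ℕ} (hq : q.Prime) (hqN : q ∣ N) :
    ((freyCurve a b).minimalDiscriminantNorm ℤ).factorization q ≤
      ∏ p ∈ N.primeFactors, ((freyCurve a b).minimalDiscriminantNorm ℤ).factorization p := by
  haveI := isElliptic_freyCurve h0
  have hone : ∀ p ∈ N.primeFactors,
      1 ≤ ((freyCurve a b).minimalDiscriminantNorm ℤ).factorization p :=
    fun p hp => (freyCurve a b).factorization_minimalDiscriminantNorm_pos_of_mem (by rw [hN]; exact hp)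
  have hqmem : q ∈ N.primeFactors := Nat.mem_primeFactors.mpr ⟨hq, hqN, NeZero.ne N⟩
  exact Finset.single_le_prod' hone hqmem

/-! ## Assembly: child 1 AT PRIME TYPE from `{XiSquareIdentity, FreyModularity}`, constant `C = 1` -/

/-- **Child 1 of the split at prime type** — verbatim the hypothesis `hC` of
`SteinbergCorePrimeRung.primeRung_of_subs_frey` (p162616) — from (H♮) and the route item
`FreyModularity` (stmt-ABC-11340), with `C = 1`: for a minimal datum `D` of `E_{a,b}`,
`cps ξ(N/q, q) ≤ cps(deg D) · c_q ≤ cps(deg D) · T ≤ 1 · N^ε · cps(deg D) · T³`.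
No `takahashi2001_thm_2_3_of_coprime`, no `MazurKenkuBound`, no `IsogenyValuationTransport`, no ARS 2.1(b).
CONDITIONAL on exactly the two hypotheses. [folklore] -/
theorem primeComparison_of_sqIdentity (hH : XiSquareIdentity) (hMod : FreyModularity) :
    ∀ ε : ℝ, 0 < ε → ∃ C : ℝ, ∀ a b : ℤ, IsCoprime a b → a * b * (a + b) ≠ 0 → ∀ (N : ℕ) [NeZero N],
      (freyCurve a b).conductorNorm ℤ = N → ∀ q : ℕ, q.Prime → q ≠ 2 → q ∣ N →
      brandtXi (N / q) q (fun n => (freyCurve a b).LFunction n) ≠ 0 →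
      ∃ D : ModularParametrizationData (freyCurve a b) N,
        (∀ D' : ModularParametrizationData (freyCurve a b) N, D.deg ≤ D'.deg) ∧
        ((brandtXi (N / q) q (fun n => (freyCurve a b).LFunction n) /
            (ordProj[2] (brandtXi (N / q) q (fun n => (freyCurve a b).LFunction n)) *
              ordProj[3] (brandtXi (N / q) q (fun n => (freyCurve a b).LFunction n))) : ℕ) : ℝ) ≤
          C * (N : ℝ) ^ ε * ((D.deg / (ordProj[2] D.deg * ordProj[3] D.deg) : ℕ) : ℝ) *
            ((∏ p ∈ N.primeFactors, ((freyCurve a b).minimalDiscriminantNorm ℤ).factorization p : ℕ) : ℝ) ^ 3 := by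
  intro ε hε
  refine ⟨1, ?_⟩
  intro a b hab h0 N _ hN q hq hq2 hqN hξ
  haveI := isElliptic_freyCurve h0
  obtain ⟨D, -, hDmin⟩ := exists_minimal_datum (hMod a b hab h0 N hN)
  refine ⟨D, hDmin, ?_⟩
  -- `ξ ∣ c_q · deg D`, as `c_q · deg D = j² ξ` through the chosen setup
  have hqmem : q ∈ ((freyCurve a b).conductorNorm ℤ).primeFactors := by
    rw [hN]; exact Nat.mem_primeFactors.mpr ⟨hq, hqN, NeZero.ne N⟩
  have hc : 0 < ((freyCurve a b).minimalDiscriminantNorm ℤ).factorization q :=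
    (freyCurve a b).factorization_minimalDiscriminantNorm_pos_of_mem hqmem
  obtain ⟨k, hk⟩ := brandtXi_dvd_tamagawa_mul_deg hH hab h0 hN hq hq2 hqN hξ D
  -- from `c · deg D = ξ · k`: `cps ξ ≤ cps (ξ k) = cps (c · deg D) ≤ cps (deg D) · c`
  have hk0 : k ≠ 0 := by
    rintro rfl
    rw [mul_zero] at hk
    exact (Nat.mul_pos hc D.deg_pos).ne' hk
  have hnat : brandtXi (N / q) q (fun n => (freyCurve a b).LFunction n) /
        (ordProj[2] (brandtXi (N / q) q (fun n => (freyCurve a b).LFunction n)) *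
          ordProj[3] (brandtXi (N / q) q (fun n => (freyCurve a b).LFunction n))) ≤
      D.deg / (ordProj[2] D.deg * ordProj[3] D.deg) *
        ∏ p ∈ N.primeFactors, ((freyCurve a b).minimalDiscriminantNorm ℤ).factorization p := by
    calc brandtXi (N / q) q (fun n => (freyCurve a b).LFunction n) /
          (ordProj[2] (brandtXi (N / q) q (fun n => (freyCurve a b).LFunction n)) *
            ordProj[3] (brandtXi (N / q) q (fun n => (freyCurve a b).LFunction n)))
        ≤ brandtXi (N / q) q (fun n => (freyCurve a b).LFunction n) * k /
            (ordProj[2] (brandtXi (N / q) q (fun n => (freyCurve a b).LFunction n) * k) *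
              ordProj[3] (brandtXi (N / q) q (fun n => (freyCurve a b).LFunction n) * k)) :=
          primeToSix_le_primeToSix_mul hk0
      _ = D.deg * ((freyCurve a b).minimalDiscriminantNorm ℤ).factorization q /
            (ordProj[2] (D.deg * ((freyCurve a b).minimalDiscriminantNorm ℤ).factorization q) *
              ordProj[3] (D.deg * ((freyCurve a b).minimalDiscriminantNorm ℤ).factorization q)) := by
          rw [← hk, mul_comm]
      _ = D.deg / (ordProj[2] D.deg * ordProj[3] D.deg) *
            (((freyCurve a b).minimalDiscriminantNorm ℤ).factorization q /
              (ordProj[2] (((freyCurve a b).minimalDiscriminantNorm ℤ).factorization q) *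
                ordProj[3] (((freyCurve a b).minimalDiscriminantNorm ℤ).factorization q))) :=
          primeToSix_mul _ _
      _ ≤ D.deg / (ordProj[2] D.deg * ordProj[3] D.deg) *
            ((freyCurve a b).minimalDiscriminantNorm ℤ).factorization q :=
          Nat.mul_le_mul_left _ (primeToSix_le _)
      _ ≤ D.deg / (ordProj[2] D.deg * ordProj[3] D.deg) *
            ∏ p ∈ N.primeFactors, ((freyCurve a b).minimalDiscriminantNorm ℤ).factorization p :=
          Nat.mul_le_mul_left _ (factorization_le_tamProd h0 hN hq hqN)
  -- to `ℝ`: insert `N^ε ≥ 1` and `T ≤ T³`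
  have hT1 : (1 : ℝ) ≤
      ((∏ p ∈ N.primeFactors, ((freyCurve a b).minimalDiscriminantNorm ℤ).factorization p : ℕ) : ℝ) := by
    exact_mod_cast (Nat.one_le_iff_ne_zero.mpr hc.ne').trans (factorization_le_tamProd h0 hN hq hqN)
  have hN1 : (1 : ℝ) ≤ (N : ℝ) := by exact_mod_cast Nat.one_le_iff_ne_zero.mpr (NeZero.ne N)
  have hrpow : (1 : ℝ) ≤ (N : ℝ) ^ ε := Real.one_le_rpow hN1 hε.le
  have hT3 : ((∏ p ∈ N.primeFactors, ((freyCurve a b).minimalDiscriminantNorm ℤ).factorization p : ℕ) : ℝ)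
      ≤ ((∏ p ∈ N.primeFactors, ((freyCurve a b).minimalDiscriminantNorm ℤ).factorization p : ℕ) : ℝ) ^ 3 :=
    le_self_pow₀ hT1 (by norm_num)
  have hcast : ((brandtXi (N / q) q (fun n => (freyCurve a b).LFunction n) /
        (ordProj[2] (brandtXi (N / q) q (fun n => (freyCurve a b).LFunction n)) *
          ordProj[3] (brandtXi (N / q) q (fun n => (freyCurve a b).LFunction n))) : ℕ) : ℝ) ≤
      ((D.deg / (ordProj[2] D.deg * ordProj[3] D.deg) : ℕ) : ℝ) *
        ((∏ p ∈ N.primeFactors, ((freyCurve a b).minimalDiscriminantNorm ℤ).factorization p : ℕ) : ℝ) := by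
    exact_mod_cast hnat
  calc ((brandtXi (N / q) q (fun n => (freyCurve a b).LFunction n) /
        (ordProj[2] (brandtXi (N / q) q (fun n => (freyCurve a b).LFunction n)) *
          ordProj[3] (brandtXi (N / q) q (fun n => (freyCurve a b).LFunction n))) : ℕ) : ℝ)
      ≤ ((D.deg / (ordProj[2] D.deg * ordProj[3] D.deg) : ℕ) : ℝ) *
        ((∏ p ∈ N.primeFactors, ((freyCurve a b).minimalDiscriminantNorm ℤ).factorization p : ℕ) : ℝ) := hcast
    _ ≤ ((D.deg / (ordProj[2] D.deg * ordProj[3] D.deg) : ℕ) : ℝ) *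
        ((∏ p ∈ N.primeFactors, ((freyCurve a b).minimalDiscriminantNorm ℤ).factorization p : ℕ) : ℝ) ^ 3 := by
      gcongr
    _ = 1 * 1 * ((D.deg / (ordProj[2] D.deg * ordProj[3] D.deg) : ℕ) : ℝ) *
        ((∏ p ∈ N.primeFactors, ((freyCurve a b).minimalDiscriminantNorm ℤ).factorization p : ℕ) : ℝ) ^ 3 := by
      ring
    _ ≤ 1 * (N : ℝ) ^ ε * ((D.deg / (ordProj[2] D.deg * ordProj[3] D.deg) : ℕ) : ℝ) *
        ((∏ p ∈ N.primeFactors, ((freyCurve a b).minimalDiscriminantNorm ℤ).factorization p : ℕ) : ℝ) ^ 3 := by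
      gcongr

/-!
## The prime rung `B♭` (one-liner, not elaborated here to keep the import closure light)

With `import Summits.ABC.ABC.Theorems.DefiniteXiSteinbergCorePrimeRung` (p162616):

```
theorem primeRung_of_sqIdentity (hH : XiSquareIdentity) (hMod : FreyModularity) (hP : ⟨P6⟩) (hT : ⟨allowance⟩) :
    ⟨B♭⟩ :=
  Summit.ABC.ABC.Theorems.SteinbergCorePrimeRung.primeRung_of_subs_frey
    (primeComparison_of_sqIdentity hH hMod) hP hT
```

(`hP`, `hT`, `B♭` verbatim the binders / conclusion of `primeRung_of_subs_frey`; the types match by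
construction since `primeComparison_of_sqIdentity` concludes its `hC` verbatim.)
-/

end Summit.ABC.ABC.Cruxes.SteinbergCore.StubIdeasK1G12

end
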